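import Mathlib
import Summits.ValiantsHypothesis.ValiantsHypothesis.Theorems.FifoMatchingNNNotVPSupportFnMatchings
import Summits.ValiantsHypothesis.ValiantsHypothesis.Theorems.FifoMatchingNNNotVPSupportFnCore
import Summits.ValiantsHypothesis.ValiantsHypothesis.Theorems.FifoMatchingNNNotVPStubSupportFnHard
import Summits.ValiantsHypothesis.ValiantsHypothesis.Theorems.FifoMatchingNNNotVPStubCertificateToSupportFn
import Literature.Computability.AlgebraicComplexity.NestFreeMatchingPoly
import HarnessLib

/-!
# Route FifoMatching — crux `NNDivisionHard` (stmt-ValiantsHypothesis-21181):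
# arcs of span `> n` are DEAD for `NN_n`, and domination is only needed MODULO DEAD ARCS

Two facts about the nest-free (FIFO) matching polynomial `NN_n` on `[2n]` and its cofactors.

1. **The span lemma** (`span_le_of_mem_nestFreeMatchings`): every arc `(i, M i)`, `i < M i`, of a
   nest-free perfect matching `M` of `[2n]` has span `M i − i ≤ n`.  Reason: a vertex strictly inside
   the arc cannot be matched inside it (that would be a nesting), so `M` injects the `M i − i − 1` inner
   vertices into the `2n − (M i − i + 1)` outer ones.  Hence the variables `x_(i,j)` with `j ≤ i` or
   `j − i > n` — about `5/8` of all `4n²` variables — never occur in `NN_n` (`dead_arcs`): they are DEAD.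

2. **Domination modulo dead arcs** (`nnDivisionHard_of_deadFreedDominated`): the Boolean-shadow
   domination rung (✓ p823553 `ShadowDominated.nnDivisionHard_of_freedDominated`) frees a set `T` of at
   most `(log₂ n + k)^k` arcs on both sides.  Arcs that NO nest-free perfect matching uses may be freed in
   the cofactor FOR FREE and in any number: for all `k c`, eventually in `n`, for all `h`, all `T` with
   `|T| ≤ (log₂ n + k)^k` and all `D` avoided by every nest-free perfect matching (e.g. any set of dead
   arcs, of any size), if `∀ A, SuppFn (NN_n|_{T:=1}) A → SuppFn (h|_{T ∪ D := 1}) A` then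
   `2^((log₂ n + c)^c) < L₊(NN_n · h) + L₊(h)`.  Proof: `g := (NN_n · h)|_{T∪D := 1}` is a free projection of
   the certificate, and its shadow is that of `NN_n|_{T:=1}` because freeing `D` does not change the shadow
   of `NN_n` (`suppFn_NN_union_avoided`); stub A (✓ p821759) prices `g`.
   Corollaries: `nnDivisionHard_of_liveDominated` (`T = ∅`, `D` = the dead arcs of the span lemma) —
   e.g. `x_(0,2n−1)^D · F_n` (a dead long arc times the vertex-star product) is NOT dominated but becomes
   dominated once the dead arc is freed, so it is decided here and not by p823553.

Honest framing: a structural lemma on `NN_n` and one more widening of a decided sub-population of 21181;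
the residual may in addition be normalised to cofactors supported on LIVE arcs (`i < j`, `j − i ≤ n`);
`NNDivisionHard`, `NNNotVP` and `VP ≠ VNP` stay OPEN (NOT proved).  No definitions, no named facts.
-/

noncomputable section

-- Sub = Summit single-conjunct layout: the duplicated namespace component is mandated by the tree.
set_option linter.dupNamespace false
set_option autoImplicit false

namespace Summit.ValiantsHypothesis.ValiantsHypothesis.Theorems.FifoMatching.NNDivisionHard.DeadArcs

open MvPolynomial Finset Literature.Computability.AlgebraicComplexity
open scoped NNReal BigOperators Classical
open Summit.ValiantsHypothesis.ValiantsHypothesis.Theorems.FifoMatching.NNNotVP.DivisionSplit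
  (σ NN SuppFn freeVars stub_supportFnHard suppFn_iff_eval_ne_zero suppFn_freeVars_iff suppFn_NN_iff
    freeVars_mul complexity_freeVars_le)

/-! ### §1 The span lemma -/

/-- **Inner vertices escape.**  In a nest-free perfect matching `M`, a vertex `j` strictly inside an
arc `(i, M i)` is matched OUTSIDE it: `M j < i` or `M i < M j` (otherwise the arc of `j` is nested in
`(i, M i)`). [folklore] -/
theorem partner_outside_of_inside {m : ℕ} {M : Fin m → Fin m} (hM : M ∈ nestFreeMatchings m)
    {i j : Fin m} (hij : i < j) (hjM : j < M i) : M j < i ∨ M i < M j := by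
  obtain ⟨hP, hnest⟩ := mem_nestFreeMatchings.1 hM
  obtain ⟨hinv, hfpf⟩ := mem_perfectMatchings.1 hP
  by_contra hout
  rw [not_or, not_lt, not_lt] at hout
  obtain ⟨h1, h2⟩ := hout
  have hMj_ne_i : M j ≠ i := by
    intro h
    have hMi : M i = j := by rw [← h, hinv]
    rw [hMi] at hjM
    exact lt_irrefl _ hjM
  have hMj_ne_Mi : M j ≠ M i := by
    intro h
    have : j = i := (Function.Involutive.injective hinv) h
    rw [this] at hij
    exact lt_irrefl _ hij
  have h1' : i < M j := lt_of_le_of_ne h1 (Ne.symm hMj_ne_i)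
  have h2' : M j < M i := lt_of_le_of_ne h2 hMj_ne_Mi
  rcases lt_or_gt_of_ne (hfpf j) with hlt | hgt
  · -- `M j < j`: the arc `(M j, j)` is nested in `(i, M i)`
    exact hnest i (M j) h1' (by rw [hinv]; exact hlt) (by rw [hinv]; exact hjM)
  · -- `j < M j`: the arc `(j, M j)` is nested in `(i, M i)`
    exact hnest i j hij hgt h2'

/-- ★ **The span lemma**: every arc `(i, M i)`, `i < M i`, of a nest-free perfect matching of `[2n]` has
`M i ≤ i + n` — `M` injects the `M i − i − 1` inner vertices into the `i + (2n − 1 − M i)` outer ones.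
[folklore] -/
theorem span_le_of_mem_nestFreeMatchings {n : ℕ} {M : Fin (2 * n) → Fin (2 * n)}
    (hM : M ∈ nestFreeMatchings (2 * n)) {i : Fin (2 * n)} (hi : i < M i) :
    (M i).val ≤ i.val + n := by
  obtain ⟨hP, -⟩ := mem_nestFreeMatchings.1 hM
  obtain ⟨hinv, -⟩ := mem_perfectMatchings.1 hP
  have hmaps : ∀ j ∈ Finset.Ioo i (M i), M j ∈ Finset.Iio i ∪ Finset.Ioi (M i) := by
    intro j hj
    rw [Finset.mem_Ioo] at hj
    rw [Finset.mem_union, Finset.mem_Iio, Finset.mem_Ioi]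
    exact partner_outside_of_inside hM hj.1 hj.2
  have hinj : Set.InjOn M (Finset.Ioo i (M i) : Set (Fin (2 * n))) :=
    (Function.Involutive.injective hinv).injOn
  have hcard := Finset.card_le_card_of_injOn M hmaps hinj
  have hIn : (Finset.Ioo i (M i)).card = (M i).val - i.val - 1 := Fin.card_Ioo i (M i)
  have hOut : (Finset.Iio i ∪ Finset.Ioi (M i)).card ≤ i.val + (2 * n - 1 - (M i).val) := by
    refine (Finset.card_union_le _ _).trans ?_
    rw [Fin.card_Iio, Fin.card_Ioi]
  have hiv : i.val < (M i).val := hi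
  have hMlt : (M i).val < 2 * n := (M i).isLt
  omega

/-- **Dead arcs.**  A pair `(a, b)` with `b ≤ a` or `a + n < b` is never an arc `(i, M i)`, `i < M i`,
of a nest-free perfect matching of `[2n]`. [folklore] -/
theorem dead_arcs {n : ℕ} {M : Fin (2 * n) → Fin (2 * n)} (hM : M ∈ nestFreeMatchings (2 * n))
    (i : Fin (2 * n)) (hi : i < M i) :
    (i, M i) ∉ (univ.filter fun e : σ n => ¬ (e.1 < e.2 ∧ e.2.val ≤ e.1.val + n)) := by
  rw [mem_filter, not_and, not_not]
  exact fun _ => ⟨hi, span_le_of_mem_nestFreeMatchings hM hi⟩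

/-! ### §2 Freeing arcs avoided by every nest-free perfect matching does not change the shadow of `NN_n` -/

/-- If every nest-free perfect matching avoids `D`, then `SuppFn NN_n (D ∪ A) ↔ SuppFn NN_n A`.
[folklore] -/
theorem suppFn_NN_union_avoided {n : ℕ} {D : Finset (σ n)}
    (hD : ∀ M ∈ nestFreeMatchings (2 * n), ∀ i : Fin (2 * n), i < M i → (i, M i) ∉ D)
    (A : Finset (σ n)) : SuppFn (NN n) (D ∪ A) ↔ SuppFn (NN n) A := by
  rw [suppFn_NN_iff, suppFn_NN_iff]
  constructor
  · rintro ⟨M, hM, hMA⟩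
    refine ⟨M, hM, fun i hi => ?_⟩
    have h := hMA i hi
    rw [Finset.mem_union] at h
    exact h.resolve_left (hD M hM i hi)
  · rintro ⟨M, hM, hMA⟩
    exact ⟨M, hM, fun i hi => Finset.mem_union_right _ (hMA i hi)⟩

/-- Hence freeing `T ∪ D` in `NN_n` has the shadow of freeing `T` alone. [folklore] -/
theorem suppFn_freeVars_union_avoided_NN {n : ℕ} (T : Finset (σ n)) {D : Finset (σ n)}
    (hD : ∀ M ∈ nestFreeMatchings (2 * n), ∀ i : Fin (2 * n), i < M i → (i, M i) ∉ D)
    (A : Finset (σ n)) : SuppFn (freeVars (T ∪ D) (NN n)) A ↔ SuppFn (freeVars T (NN n)) A := by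
  rw [suppFn_freeVars_iff, suppFn_freeVars_iff, suppFn_NN_iff, suppFn_NN_iff]
  constructor
  · rintro ⟨M, hM, hMA⟩
    refine ⟨M, hM, fun i hi => ?_⟩
    have h := hMA i hi
    simp only [Finset.mem_union] at h ⊢
    rcases h with (hT | hD') | hA
    · exact Or.inl hT
    · exact absurd hD' (hD M hM i hi)
    · exact Or.inr hA
  · rintro ⟨M, hM, hMA⟩
    refine ⟨M, hM, fun i hi => ?_⟩
    have h := hMA i hi
    simp only [Finset.mem_union] at h ⊢
    rcases h with hT | hA
    · exact Or.inl (Or.inl hT)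
    · exact Or.inr hA

/-! ### §3 Domination modulo avoided (e.g. dead) arcs -/

/-- ★ **Domination modulo avoided arcs decides the cofactor.**  For all `k c`, eventually in `n`: for
every cofactor `h`, every `T` with `|T| ≤ (log₂ n + k)^k` and every `D` avoided by all nest-free perfect
matchings (any size), if `∀ A, SuppFn (NN_n|_{T:=1}) A → SuppFn (h|_{T ∪ D := 1}) A` then
`2^((log₂ n + c)^c) < L₊(NN_n · h) + L₊(h)`. [folklore] -/
theorem nnDivisionHard_of_deadFreedDominated (k c : ℕ) :
    ∃ n₀ : ℕ, ∀ n ≥ n₀, ∀ h : MvPolynomial (Fin (2 * n) × Fin (2 * n)) ℝ≥0, ∀ T D : Finset (σ n),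
      T.card ≤ (Nat.log 2 n + k) ^ k →
      (∀ M ∈ nestFreeMatchings (2 * n), ∀ i : Fin (2 * n), i < M i → (i, M i) ∉ D) →
      (∀ A : Finset (σ n), SuppFn (freeVars T (NN n)) A → SuppFn (freeVars (T ∪ D) h) A) →
      2 ^ ((Nat.log 2 n + c) ^ c) < complexity (nestFreeMatchingPoly n ℝ≥0 * h) + complexity h := by
  obtain ⟨n₀, hn₀⟩ := stub_supportFnHard k c
  refine ⟨n₀, fun n hn h T D hT hD hdom => ?_⟩
  have hg : ∀ A : Finset (σ n),
      SuppFn (freeVars (T ∪ D) (NN n * h)) A ↔ SuppFn (freeVars T (NN n)) A := by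
    intro A
    rw [freeVars_mul, suppFn_iff_eval_ne_zero, map_mul, mul_ne_zero_iff, ← suppFn_iff_eval_ne_zero,
      ← suppFn_iff_eval_ne_zero, suppFn_freeVars_union_avoided_NN T hD A]
    exact ⟨fun h2 => h2.1, fun h1 => ⟨h1, hdom A h1⟩⟩
  calc 2 ^ ((Nat.log 2 n + c) ^ c) < complexity (freeVars (T ∪ D) (NN n * h)) := hn₀ n hn T hT _ hg
    _ ≤ complexity (NN n * h) := complexity_freeVars_le _ _
    _ ≤ complexity (nestFreeMatchingPoly n ℝ≥0 * h) + complexity h := Nat.le_add_right _ _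

/-- **Domination modulo the dead arcs of the span lemma** (`T = ∅`): for every `c`, eventually in `n`,
if the shadow of `h` with all dead arcs (`j ≤ i` or `j − i > n`) freed is implied by nest-free
perfect-matching existence, then `2^((log₂ n + c)^c) < L₊(NN_n · h) + L₊(h)`. [folklore] -/
theorem nnDivisionHard_of_liveDominated (c : ℕ) :
    ∃ n₀ : ℕ, ∀ n ≥ n₀, ∀ h : MvPolynomial (Fin (2 * n) × Fin (2 * n)) ℝ≥0,
      (∀ A : Finset (σ n), SuppFn (NN n) A →
        SuppFn (freeVars (univ.filter fun e : σ n => ¬ (e.1 < e.2 ∧ e.2.val ≤ e.1.val + n)) h) A) →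
      2 ^ ((Nat.log 2 n + c) ^ c) < complexity (nestFreeMatchingPoly n ℝ≥0 * h) + complexity h := by
  obtain ⟨n₀, hn₀⟩ := nnDivisionHard_of_deadFreedDominated 0 c
  refine ⟨n₀, fun n hn h hdom => hn₀ n hn h ∅ _ (by simp) (fun M hM i hi => dead_arcs hM i hi) ?_⟩
  intro A hA
  -- `hA : SuppFn (NN n|_{∅ := 1}) A`, i.e. `SuppFn (NN n) A`
  have hA' : SuppFn (NN n) A := by
    rw [suppFn_freeVars_iff] at hA
    refine hA.mono fun x hx => ?_
    simp only [Finset.mem_union, Finset.notMem_empty, false_or] at hx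
    exact hx
  have h1 := hdom A hA'
  rw [suppFn_freeVars_iff] at h1 ⊢
  refine h1.mono fun x hx => ?_
  simp only [Finset.mem_union, Finset.notMem_empty, false_or] at hx ⊢
  exact hx

/-! ### §4 The live band of `NN_n`, as statements about monomials and variables -/

/-- **Every arc of every monomial of `NN_n` is LIVE**: if `x^d` is a monomial of `NN_n` and `e = (i, j)`
occurs in it, then `i < j` and `j ≤ i + n` (the monomials of `NN_n` are the arc sets of nest-free
perfect matchings, `support_nestFreeMatchingPoly`; span lemma). [folklore] -/
theorem live_of_mem_support_NN {n : ℕ} {d : σ n →₀ ℕ} (hd : d ∈ (NN n).support) {e : σ n}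
    (he : e ∈ d.support) : e.1 < e.2 ∧ e.2.val ≤ e.1.val + n := by
  have hsupp : (NN n).support = (nestFreeMatchings (2 * n)).image arcExponent :=
    support_nestFreeMatchingPoly n
  rw [hsupp, Finset.mem_image] at hd
  obtain ⟨M, hM, rfl⟩ := hd
  obtain ⟨h1, h2⟩ :=
    (Summit.ValiantsHypothesis.ValiantsHypothesis.Theorems.FifoMatching.NNNotVP.DivisionSplit.mem_support_arcExponent
      M e).1 he
  have hspan := span_le_of_mem_nestFreeMatchings hM h1
  rw [h2] at h1 hspan
  exact ⟨h1, hspan⟩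

/-- **The variables of `NN_n` lie in the live band**: `(i, j) ∈ vars NN_n → i < j ∧ j ≤ i + n`; the
other `x_(i,j)` (about `5/8` of all `4n²` variables) are dead. [folklore] -/
theorem live_of_mem_vars_NN {n : ℕ} {e : σ n} (he : e ∈ (NN n).vars) :
    e.1 < e.2 ∧ e.2.val ≤ e.1.val + n := by
  obtain ⟨d, hd, hed⟩ := (mem_vars_iff_mem_support e).1 he
  exact live_of_mem_support_NN hd hed

/-! ### §5 Cofactors with a DEAD MONOMIAL are decided -/

/-- Freeing a superset `D` of the variables of a monomial `x^m` of `h` produces a nonzero CONSTANT term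
(`x^m ↦ coeff m h > 0`; over `ℝ≥0` nothing cancels it). [folklore] -/
theorem zero_mem_support_freeVars_of_subset {τ : Type*} (h : MvPolynomial τ ℝ≥0) {m : τ →₀ ℕ}
    (hm : m ∈ h.support) {D : Finset τ} (hmD : m.support ⊆ D) :
    (0 : τ →₀ ℕ) ∈ (freeVars D h).support := by
  set φ : τ → MvPolynomial τ ℝ≥0 :=
    fun v => if v ∈ D then (1 : MvPolynomial τ ℝ≥0) else X v with hφ
  have hexp : freeVars D h = ∑ d ∈ h.support, C (coeff d h) * ∏ i ∈ d.support, φ i ^ d i := by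
    unfold freeVars
    rw [MvPolynomial.aeval_def, MvPolynomial.eval₂_eq]
    rfl
  have hprod : ∏ i ∈ m.support, φ i ^ m i = 1 := by
    refine Finset.prod_eq_one fun i hi => ?_
    simp only [hφ, hmD hi, if_true, one_pow]
  have hterm : coeff 0 (C (coeff m h) * ∏ i ∈ m.support, φ i ^ m i) = coeff m h := by
    rw [hprod, mul_one, coeff_C, if_pos rfl]
  have hle : coeff m h ≤ coeff 0 (freeVars D h) := by
    rw [hexp, coeff_sum, ← hterm]
    exact Finset.single_le_sum
      (f := fun d => coeff 0 (C (coeff d h) * ∏ i ∈ d.support, φ i ^ d i))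
      (fun _ _ => zero_le) hm
  rw [mem_support_iff] at hm ⊢
  exact (lt_of_lt_of_le (pos_iff_ne_zero.2 hm) hle).ne'

/-- ★ **A dead monomial decides the cofactor.**  For every `c`, eventually in `n`: if SOME monomial of
`h` consists of dead variables only (loops `x_(i,i)`, backward pairs `x_(j,i)` with `j > i`, long arcs of
span `> n` — any number of them, any multiplicities), then `2^((log₂ n + c)^c) < L₊(NN_n · h) + L₊(h)`:
freeing the dead arcs gives `h` a constant term, hence an identically-true shadow, hence domination
(`nnDivisionHard_of_liveDominated`). [folklore] -/
theorem nnDivisionHard_of_deadMonomial (c : ℕ) :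
    ∃ n₀ : ℕ, ∀ n ≥ n₀, ∀ h : MvPolynomial (Fin (2 * n) × Fin (2 * n)) ℝ≥0,
      (∃ m ∈ h.support, ∀ e ∈ m.support, ¬ (e.1 < e.2 ∧ e.2.val ≤ e.1.val + n)) →
      2 ^ ((Nat.log 2 n + c) ^ c) < complexity (nestFreeMatchingPoly n ℝ≥0 * h) + complexity h := by
  obtain ⟨n₀, hn₀⟩ := nnDivisionHard_of_liveDominated c
  refine ⟨n₀, fun n hn h hdead => hn₀ n hn h fun A _ => ?_⟩
  obtain ⟨m, hm, hmdead⟩ := hdead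
  have hmD : m.support ⊆ (univ.filter fun e : σ n => ¬ (e.1 < e.2 ∧ e.2.val ≤ e.1.val + n)) :=
    fun e he => mem_filter.2 ⟨mem_univ _, hmdead e he⟩
  exact ⟨0, zero_mem_support_freeVars_of_subset h hm hmD, by simp⟩

end Summit.ValiantsHypothesis.ValiantsHypothesis.Theorems.FifoMatching.NNDivisionHard.DeadArcs

end
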